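import Mathlib.Analysis.SpecialFunctions.Pow.Real
import Literature.Combinatorics.BinomialEntropyBound
import Literature.InformationTheory.QuantumCodes.CSSGilbertVarshamov
import HarnessLib

/-!
# The asymptotic Gilbert–Varshamov bound for CSS codes (Matsumoto 2017, Corollary 1)

Topic `Literature/InformationTheory/QuantumCodes` (LADDER-QEC, LIT-1 custody: LOWER-bound column for CSS
codes, asymptotic form). Everything here is PROVED (no named facts). Kept in its own leaf so that the
finite file `CSSGilbertVarshamov.lean` stays free of real analysis.

**Source.** R. Matsumoto, *Two Gilbert–Varshamov-type existential bounds for asymmetric quantum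
error-correcting codes*, Quantum Inf. Process. 16 (2017), no. 12 = arXiv:1705.04087 [Matsumoto2017],
§2 (held text, chunk p0004):

> Recall that for `0 ≤ δ ≤ 1 − 1/q` we have `Σ_{i=1}^{⌊nδ⌋} C(n,i)(q−1)^i ≤ q^{n h_q(δ)}`.
> **Corollary 1.** Let `δ_x` and `δ_z` be real numbers such that `0 ≤ δ_x ≤ 1 − 1/q` and
> `0 ≤ δ_z ≤ 1 − 1/q`. If `h_q(δ_x) < 1 − R₁`, `h_q(δ_z) < R₂`, and `0 ≤ R₁ − R₂`, then, for sufficiently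
> large `n`, there exists an `[[n, nR₁ − nR₂, nδ_x, nδ_z]]_q` CSS QECC.

(printed proof: for large `n`, `(q^{nR₁} − q^{nR₂})/(qⁿ−1) · Σ_{i=1}^{nδ_x−1} … < 1/2` and
`(q^{n−nR₂} − q^{n−nR₁})/(qⁿ−1) · Σ_{i=1}^{nδ_z−1} … < 1/2`, so the hypothesis of Theorem 1 holds.)

**What is proved here** (`q = 2`; tree naming of `CSSGilbertVarshamov.lean`: `C₁ ≤ C₂`, so the
paper's `R₁` is the rate of the LARGER code `C₂` and `R₂` that of `C₁`; entropies in nats, Mathlib's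
`Real.binEntropy`, so `h₂(δ) < ρ` reads `binEntropy δ < ρ · log 2`; the non-integers `nR`, `nδ` are
rounded as `dim = ⌊R n⌋`, `distance = ⌈δ n⌉`):

* `Matsumoto2017_corollary1` — if `0 ≤ δ_x, δ_z ≤ 1/2`, `binEntropy δ_x < (1 − R₁) log 2`,
  `binEntropy δ_z < R₂ log 2` and `R₂ ≤ R₁`, then there is `N` such that for every `n ≥ N` there are
  binary linear codes `C₁ ≤ C₂ ≤ 𝔽₂ⁿ` with `dim C₁ = ⌊R₂ n⌋`, `dim C₂ = ⌊R₁ n⌋`, every word of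
  `C₂ ∖ C₁` of weight `≥ ⌈δ_x n⌉` and every word of `C₁⊥ ∖ C₂⊥` of weight `≥ ⌈δ_z n⌉`
  (an `[[n, ⌊R₁n⌋ − ⌊R₂n⌋, ⌈δ_x n⌉ / ⌈δ_z n⌉]]` CSS code);
* `Matsumoto2017_corollary1_additiveCodeExists` — the symmetric stabilizer reading through CRSS
  Thm. 9: an `[[n, ⌊R₁n⌋ − ⌊R₂n⌋, min(⌈δ_x n⌉, ⌈δ_z n⌉)]]` additive code exists for all large `n`
  (`R₂ < R₁`);
* `CalderbankShor1996_rate` — the Calderbank–Shor form: `2H₂(δ) < 1 − R`, `R > 0` ⇒ for all large `n`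
  an `[[n, k ≥ Rn − 1, ⌈δn⌉]]` code exists ("asymptotic rate `1 − 2H₂(2t/n)`", [CalderbankShor1996]).

The proof is the printed one, made effective: with `a = (1 − R₁) log 2 − H(δ_x) > 0`,
`b = R₂ log 2 − H(δ_z) > 0` and van Lint's bound `Σ_{i ≤ δn} C(n,i) ≤ e^{n H(δ)}`
(`Literature.Combinatorics.vanLint_sum_choose_le_exp_binEntropy`), the two terms of Theorem 1 are
`≤ 2ⁿ e^{−na}` and `≤ 2·2ⁿ e^{−nb}`, hence `< 2ⁿ − 1` as soon as `na, nb ≥ log 8` and `n ≥ 1`.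

## Tree / Mathlib search

`rg binEntropy Literature/InformationTheory` (2026-08-27): entropy-form GV statements exist for
classical codes (`Coding/GilbertVarshamovDualBinary.lean`) and as hypotheses of the qLDPC existence
facts (`GoodQLDPC.lean`); no asymptotic CSS / quantum GV bound. Reused: `Matsumoto2017_theorem1`
(`CSSGilbertVarshamov.lean`), `vanLint_sum_choose_le_exp_binEntropy`, `CRSS1998_theorem9_css_holds`.
-/

namespace Literature.InformationTheory.QuantumCodes

open Finset Module Coding Real

/-- The binomial sum of Theorem 1 under the entropy bound:
`Σ_{i=1}^{⌈δn⌉−1} C(n,i) ≤ Σ_{i ≤ ⌊δn⌋} C(n,i) ≤ e^{n H(δ)}` for `0 ≤ δ ≤ 1/2`.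
[cite: Matsumoto2017, §2 (chunk p0004: "for 0 ≤ δ ≤ 1−1/q we have Σ_{i=1}^{⌊nδ⌋} C(n,i)(q−1)^i ≤ q^{n h_q(δ)}"); Vanlint1992, Theorem 1.4.5 (i) (pp. 66–67)] -/
theorem sum_Ico_ceil_choose_le_exp_binEntropy (n : ℕ) {δ : ℝ} (h0 : 0 ≤ δ) (h1 : δ ≤ 1 / 2) :
    ((∑ i ∈ Finset.Ico 1 ⌈δ * n⌉₊, n.choose i : ℕ) : ℝ) ≤ Real.exp (n * binEntropy δ) := by
  have hsub : Finset.Ico 1 ⌈δ * n⌉₊ ⊆ Finset.range (⌊δ * n⌋₊ + 1) := by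
    intro i hi
    rw [Finset.mem_Ico] at hi
    rw [Finset.mem_range]
    have := Nat.ceil_le_floor_add_one (δ * n)
    omega
  calc ((∑ i ∈ Finset.Ico 1 ⌈δ * n⌉₊, n.choose i : ℕ) : ℝ)
      ≤ ((∑ i ∈ Finset.range (⌊δ * n⌋₊ + 1), n.choose i : ℕ) : ℝ) := by
        exact_mod_cast Finset.sum_le_sum_of_subset hsub
    _ = ∑ i ∈ Finset.range (⌊δ * n⌋₊ + 1), (n.choose i : ℝ) := by norm_cast
    _ ≤ Real.exp (n * binEntropy δ) :=
        Literature.Combinatorics.vanLint_sum_choose_le_exp_binEntropy n h0 h1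

/-- `2^k = e^{k log 2}`. [folklore] -/
private theorem two_pow_eq_exp (k : ℕ) : (2 : ℝ) ^ k = Real.exp (k * Real.log 2) := by
  rw [← Real.rpow_natCast, Real.rpow_def_of_pos two_pos, mul_comm]

/-- From `log 8 ≤ x`: `e^{−x} ≤ 1/8`. [folklore] -/
private theorem exp_neg_le_eighth {x : ℝ} (hx : Real.log 8 ≤ x) : Real.exp (-x) ≤ 1 / 8 := by
  rw [Real.exp_neg, one_div]
  refine inv_anti₀ (by norm_num) ?_
  calc (8 : ℝ) = Real.exp (Real.log 8) := by rw [Real.exp_log (by norm_num)]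
    _ ≤ Real.exp x := Real.exp_le_exp.2 hx

/-- **Corollary 1 (Matsumoto), the asymptotic binary CSS Gilbert–Varshamov bound.** Let
`0 ≤ δ_x, δ_z ≤ 1/2` and rates `R₂ ≤ R₁` with `h₂(δ_x) < 1 − R₁` and `h₂(δ_z) < R₂` (binary entropy;
here `binEntropy δ < ρ · log 2`). Then for all sufficiently large `n` there are nested binary linear
codes `C₁ ≤ C₂ ≤ 𝔽₂ⁿ` of dimensions `⌊R₂n⌋ ≤ ⌊R₁n⌋` such that every word of `C₂ ∖ C₁` has weight
`≥ ⌈δ_x n⌉` and every word of `C₁⊥ ∖ C₂⊥` has weight `≥ ⌈δ_z n⌉` — an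
`[[n, ⌊R₁n⌋ − ⌊R₂n⌋, ⌈δ_x n⌉ / ⌈δ_z n⌉]]` CSS code (the case `R₂ = 1 − R₁`, `δ_x = δ_z = δ` is the
Calderbank–Shor–Steane rate `1 − 2h₂(δ)`).
[cite: Matsumoto2017, §2 Cor. 1 (arXiv:1705.04087 chunk p0004: "then, for sufficiently large n, there exists an [[n, nR₁ − nR₂, nδ_x, nδ_z]]_q CSS QECC")] -/
theorem Matsumoto2017_corollary1 {δx δz R₁ R₂ : ℝ}
    (hδx0 : 0 ≤ δx) (hδx : δx ≤ 1 / 2) (hδz0 : 0 ≤ δz) (hδz : δz ≤ 1 / 2) (hR : R₂ ≤ R₁)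
    (hx : binEntropy δx < (1 - R₁) * Real.log 2) (hz : binEntropy δz < R₂ * Real.log 2) :
    ∃ N : ℕ, ∀ n ≥ N, ∃ C₁ C₂ : Submodule (ZMod 2) (Fin n → ZMod 2), C₁ ≤ C₂ ∧
      finrank (ZMod 2) C₁ = ⌊R₂ * n⌋₊ ∧ finrank (ZMod 2) C₂ = ⌊R₁ * n⌋₊ ∧
      (∀ c ∈ C₂, c ∉ C₁ → ⌈δx * n⌉₊ ≤ hammingNorm c) ∧
      (∀ c ∈ dualCode C₁, c ∉ dualCode C₂ → ⌈δz * n⌉₊ ≤ hammingNorm c) := by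
  have hHx : 0 ≤ binEntropy δx := binEntropy_nonneg hδx0 (by linarith)
  have hHz : 0 ≤ binEntropy δz := binEntropy_nonneg hδz0 (by linarith)
  have hlog2 : 0 < Real.log 2 := Real.log_pos one_lt_two
  -- the two exponential gaps
  obtain ⟨a, ha⟩ : ∃ a : ℝ, a = (1 - R₁) * Real.log 2 - binEntropy δx := ⟨_, rfl⟩
  obtain ⟨b, hb⟩ : ∃ b : ℝ, b = R₂ * Real.log 2 - binEntropy δz := ⟨_, rfl⟩
  have ha0 : 0 < a := by rw [ha]; linarith
  have hb0 : 0 < b := by rw [hb]; linarith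
  have hR₁ : R₁ < 1 := by nlinarith
  have hR₂ : 0 < R₂ := by nlinarith
  refine ⟨max 1 (max ⌈Real.log 8 / a⌉₊ ⌈Real.log 8 / b⌉₊), fun n hn => ?_⟩
  have hn1 : 1 ≤ n := le_trans (le_max_left _ _) hn
  have hnr : (1 : ℝ) ≤ n := by exact_mod_cast hn1
  have hn0 : (0 : ℝ) ≤ n := by linarith
  have hna : Real.log 8 ≤ n * a := by
    have h1 : ⌈Real.log 8 / a⌉₊ ≤ n := le_trans (le_trans (le_max_left _ _) (le_max_right _ _)) hn
    have h2 : Real.log 8 / a ≤ n := le_trans (Nat.le_ceil _) (by exact_mod_cast h1)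
    rw [div_le_iff₀ ha0] at h2
    linarith
  have hnb : Real.log 8 ≤ n * b := by
    have h1 : ⌈Real.log 8 / b⌉₊ ≤ n := le_trans (le_trans (le_max_right _ _) (le_max_right _ _)) hn
    have h2 : Real.log 8 / b ≤ n := le_trans (Nat.le_ceil _) (by exact_mod_cast h1)
    rw [div_le_iff₀ hb0] at h2
    linarith
  have hea := exp_neg_le_eighth hna
  have heb := exp_neg_le_eighth hnb
  -- the parameters
  have hk12 : ⌊R₂ * n⌋₊ ≤ ⌊R₁ * n⌋₊ := Nat.floor_le_floor (mul_le_mul_of_nonneg_right hR hn0)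
  have hk2n : ⌊R₁ * n⌋₊ ≤ n := by
    have h1 : R₁ * n ≤ n := by nlinarith
    calc ⌊R₁ * n⌋₊ ≤ ⌊(n : ℝ)⌋₊ := Nat.floor_le_floor h1
      _ = n := Nat.floor_natCast n
  have hk1n : ⌊R₂ * n⌋₊ ≤ n := hk12.trans hk2n
  -- real bounds on the two powers of two
  have hpow2 : (2 : ℝ) ^ ⌊R₁ * n⌋₊ ≤ Real.exp (R₁ * n * Real.log 2) := by
    have h1 : (⌊R₁ * n⌋₊ : ℝ) ≤ R₁ * n := Nat.floor_le (by nlinarith)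
    rw [two_pow_eq_exp]
    exact Real.exp_le_exp.2 (mul_le_mul_of_nonneg_right h1 hlog2.le)
  have hpow1 : (2 : ℝ) ^ (n - ⌊R₂ * n⌋₊) ≤ Real.exp ((n - R₂ * n + 1) * Real.log 2) := by
    have h1 : R₂ * n < ⌊R₂ * n⌋₊ + 1 := Nat.lt_floor_add_one _
    have h2 : ((n - ⌊R₂ * n⌋₊ : ℕ) : ℝ) ≤ n - R₂ * n + 1 := by
      rw [Nat.cast_sub hk1n]
      linarith
    rw [two_pow_eq_exp]
    exact Real.exp_le_exp.2 (mul_le_mul_of_nonneg_right h2 hlog2.le)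
  have hSx := sum_Ico_ceil_choose_le_exp_binEntropy n hδx0 hδx
  have hSz := sum_Ico_ceil_choose_le_exp_binEntropy n hδz0 hδz
  have hE : (2 : ℝ) ^ n = Real.exp (n * Real.log 2) := two_pow_eq_exp n
  have hE2 : (2 : ℝ) ≤ (2 : ℝ) ^ n := by
    calc (2 : ℝ) = 2 ^ 1 := (pow_one _).symm
      _ ≤ 2 ^ n := pow_le_pow_right₀ one_le_two hn1
  -- the two terms of Theorem 1
  have hT1 : (2 : ℝ) ^ ⌊R₁ * n⌋₊ * ((∑ i ∈ Finset.Ico 1 ⌈δx * n⌉₊, n.choose i : ℕ) : ℝ) ≤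
      (2 : ℝ) ^ n / 8 := by
    calc (2 : ℝ) ^ ⌊R₁ * n⌋₊ * ((∑ i ∈ Finset.Ico 1 ⌈δx * n⌉₊, n.choose i : ℕ) : ℝ)
        ≤ Real.exp (R₁ * n * Real.log 2) * Real.exp (n * binEntropy δx) :=
          mul_le_mul hpow2 hSx (by positivity) (by positivity)
      _ = Real.exp (n * Real.log 2 + -(n * a)) := by
          rw [← Real.exp_add]
          congr 1
          rw [ha]
          ring
      _ = (2 : ℝ) ^ n * Real.exp (-(n * a)) := by rw [Real.exp_add, hE]
      _ ≤ (2 : ℝ) ^ n / 8 := by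
          have : (2 : ℝ) ^ n * Real.exp (-(n * a)) ≤ 2 ^ n * (1 / 8) :=
            mul_le_mul_of_nonneg_left hea (by positivity)
          linarith
  have hT2 : (2 : ℝ) ^ (n - ⌊R₂ * n⌋₊) * ((∑ i ∈ Finset.Ico 1 ⌈δz * n⌉₊, n.choose i : ℕ) : ℝ) ≤
      (2 : ℝ) ^ n / 4 := by
    calc (2 : ℝ) ^ (n - ⌊R₂ * n⌋₊) * ((∑ i ∈ Finset.Ico 1 ⌈δz * n⌉₊, n.choose i : ℕ) : ℝ)
        ≤ Real.exp ((n - R₂ * n + 1) * Real.log 2) * Real.exp (n * binEntropy δz) :=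
          mul_le_mul hpow1 hSz (by positivity) (by positivity)
      _ = Real.exp (n * Real.log 2 + -(n * b) + Real.log 2) := by
          rw [← Real.exp_add]
          congr 1
          rw [hb]
          ring
      _ = (2 : ℝ) ^ n * (2 * Real.exp (-(n * b))) := by
          rw [Real.exp_add, Real.exp_add, Real.exp_log two_pos, hE]
          ring
      _ ≤ (2 : ℝ) ^ n / 4 := by
          have : (2 : ℝ) ^ n * (2 * Real.exp (-(n * b))) ≤ 2 ^ n * (2 * (1 / 8)) :=
            mul_le_mul_of_nonneg_left (by linarith) (by positivity)
          linarith
  -- the hypothesis of Theorem 1, in `ℕ`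
  have key : (2 ^ ⌊R₁ * n⌋₊ - 2 ^ ⌊R₂ * n⌋₊) * ∑ i ∈ Finset.Ico 1 ⌈δx * n⌉₊, n.choose i +
      (2 ^ (n - ⌊R₂ * n⌋₊) - 2 ^ (n - ⌊R₁ * n⌋₊)) * ∑ i ∈ Finset.Ico 1 ⌈δz * n⌉₊, n.choose i <
        2 ^ n - 1 := by
    have h1 : (2 ^ ⌊R₁ * n⌋₊ - 2 ^ ⌊R₂ * n⌋₊) * ∑ i ∈ Finset.Ico 1 ⌈δx * n⌉₊, n.choose i +
        (2 ^ (n - ⌊R₂ * n⌋₊) - 2 ^ (n - ⌊R₁ * n⌋₊)) * ∑ i ∈ Finset.Ico 1 ⌈δz * n⌉₊, n.choose i ≤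
        2 ^ ⌊R₁ * n⌋₊ * ∑ i ∈ Finset.Ico 1 ⌈δx * n⌉₊, n.choose i +
          2 ^ (n - ⌊R₂ * n⌋₊) * ∑ i ∈ Finset.Ico 1 ⌈δz * n⌉₊, n.choose i :=
      Nat.add_le_add (Nat.mul_le_mul_right _ (Nat.sub_le _ _))
        (Nat.mul_le_mul_right _ (Nat.sub_le _ _))
    have h2 : ((2 ^ ⌊R₁ * n⌋₊ * ∑ i ∈ Finset.Ico 1 ⌈δx * n⌉₊, n.choose i +
        2 ^ (n - ⌊R₂ * n⌋₊) * ∑ i ∈ Finset.Ico 1 ⌈δz * n⌉₊, n.choose i : ℕ) : ℝ) <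
        ((2 ^ n - 1 : ℕ) : ℝ) := by
      rw [Nat.cast_sub Nat.one_le_two_pow]
      simp only [Nat.cast_add, Nat.cast_mul, Nat.cast_pow, Nat.cast_ofNat, Nat.cast_one]
      linarith
    exact lt_of_le_of_lt h1 (Nat.cast_lt.1 h2)
  exact Matsumoto2017_theorem1 hk12 hk2n key

/-- **Corollary 1, stabilizer reading**: under the same hypotheses with `R₂ < R₁`, for all large `n`
an `[[n, ⌊R₁n⌋ − ⌊R₂n⌋, min(⌈δ_x n⌉, ⌈δ_z n⌉)]]` additive code exists (CRSS Thm. 9 applied to the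
nested pair; `⌊R₂n⌋ < ⌊R₁n⌋` once `(R₁ − R₂) n ≥ 1`).
[cite: Matsumoto2017, §2 Cor. 1 (chunk p0004); CalderbankEtAl1998, §5 Thm. 9 (printed p. 15)] -/
theorem Matsumoto2017_corollary1_additiveCodeExists {δx δz R₁ R₂ : ℝ}
    (hδx0 : 0 ≤ δx) (hδx : δx ≤ 1 / 2) (hδz0 : 0 ≤ δz) (hδz : δz ≤ 1 / 2) (hR : R₂ < R₁)
    (hx : binEntropy δx < (1 - R₁) * Real.log 2) (hz : binEntropy δz < R₂ * Real.log 2) :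
    ∃ N : ℕ, ∀ n ≥ N,
      AdditiveCodeExists n (⌊R₁ * n⌋₊ - ⌊R₂ * n⌋₊) (min ⌈δx * n⌉₊ ⌈δz * n⌉₊) := by
  obtain ⟨N, hN⟩ := Matsumoto2017_corollary1 hδx0 hδx hδz0 hδz hR.le hx hz
  have hHz : 0 ≤ binEntropy δz := binEntropy_nonneg hδz0 (by linarith)
  have hlog2 : 0 < Real.log 2 := Real.log_pos one_lt_two
  have hR₂ : 0 < R₂ := by nlinarith
  have hgap : 0 < R₁ - R₂ := by linarith
  refine ⟨max N ⌈1 / (R₁ - R₂)⌉₊, fun n hn => ?_⟩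
  obtain ⟨C₁, C₂, h12, hk1, hk2, hX, hZ⟩ := hN n (le_trans (le_max_left _ _) hn)
  have hn0 : (0 : ℝ) ≤ n := Nat.cast_nonneg n
  have hn' : 1 / (R₁ - R₂) ≤ n :=
    le_trans (Nat.le_ceil _) (by exact_mod_cast le_trans (le_max_right _ _) hn)
  have h1 : 1 ≤ (R₁ - R₂) * n := by
    rw [div_le_iff₀ hgap] at hn'
    linarith
  have hlt : ⌊R₂ * (n : ℝ)⌋₊ < ⌊R₁ * (n : ℝ)⌋₊ := by
    have h2 : R₂ * n + 1 ≤ R₁ * n := by nlinarith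
    have h3 : ⌊R₂ * (n : ℝ) + 1⌋₊ ≤ ⌊R₁ * (n : ℝ)⌋₊ := Nat.floor_le_floor h2
    rw [Nat.floor_add_one (mul_nonneg hR₂.le hn0)] at h3
    omega
  obtain ⟨hself, hdim, hdist⟩ := CRSS1998_theorem9_css_holds n C₁ C₂ h12
  refine ⟨cssSpace C₁ C₂, hself, by rw [hk1, hk2] at hdim; omega, ?_, fun hk0 => by omega⟩
  exact (hdist _).2
    ⟨fun c hc hc' => (min_le_left _ _).trans (hX c hc hc'),
      fun c hc hc' => (min_le_right _ _).trans (hZ c hc hc')⟩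

/-- **"Good quantum error-correcting codes exist" (Calderbank–Shor 1996), rate form `1 − 2H₂(δ)`.**
If `0 ≤ δ ≤ 1/2`, `0 < R` and `2H₂(δ) < 1 − R` (nats: `2·binEntropy δ < (1 − R) log 2`), then for
all sufficiently large `n` there is an `[[n, k, ⌈δn⌉]]` additive (CSS) code with `k ≥ Rn − 1`
(Corollary 1 with `R₁ = (1+R)/2`, `R₂ = (1−R)/2`, `δ_x = δ_z = δ`; the printed statement has
`δ = 2t/n` for `t` corrected errors).
[cite: CalderbankShor1996, Abstract and §1 (arXiv:quant-ph/9512032 chunk p0003 L35–37: "codes encoding k qubits into n qubits that correct t errors and have asymptotic rate 1 − 2H₂(2t/n) as n → ∞"); Matsumoto2017, §2 Cor. 1 (chunk p0004)] -/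
theorem CalderbankShor1996_rate {δ R : ℝ} (hδ0 : 0 ≤ δ) (hδ : δ ≤ 1 / 2) (hR : 0 < R)
    (hgv : 2 * binEntropy δ < (1 - R) * Real.log 2) :
    ∃ N : ℕ, ∀ n ≥ N, ∃ k : ℕ, R * n - 1 ≤ k ∧ AdditiveCodeExists n k ⌈δ * n⌉₊ := by
  have hlog2 : 0 < Real.log 2 := Real.log_pos one_lt_two
  have hH : 0 ≤ binEntropy δ := binEntropy_nonneg hδ0 (by linarith)
  have hR1 : R < 1 := by nlinarith
  obtain ⟨N, hN⟩ := Matsumoto2017_corollary1_additiveCodeExists (R₁ := (1 + R) / 2)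
    (R₂ := (1 - R) / 2) hδ0 hδ hδ0 hδ (by linarith) (by nlinarith) (by nlinarith)
  refine ⟨N, fun n hn => ⟨⌊(1 + R) / 2 * n⌋₊ - ⌊(1 - R) / 2 * n⌋₊, ?_, ?_⟩⟩
  · have hn0 : (0 : ℝ) ≤ n := Nat.cast_nonneg n
    have hle : ⌊(1 - R) / 2 * (n : ℝ)⌋₊ ≤ ⌊(1 + R) / 2 * (n : ℝ)⌋₊ :=
      Nat.floor_le_floor (by nlinarith)
    have h1 : (1 + R) / 2 * n < ⌊(1 + R) / 2 * (n : ℝ)⌋₊ + 1 := Nat.lt_floor_add_one _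
    have h2 : (⌊(1 - R) / 2 * (n : ℝ)⌋₊ : ℝ) ≤ (1 - R) / 2 * n := Nat.floor_le (by nlinarith)
    rw [Nat.cast_sub hle]
    linarith
  · have := hN n hn
    rwa [min_self] at this

end Literature.InformationTheory.QuantumCodes
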